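import Literature.MathematicalPhysics.QuantumManyBody.SwapPurity
import Summits.AtomisticToContinuum.BoseEinsteinCondensation.Theorems.SoloInformedModeCriterion

/-!
# Zero-momentum condensation ⇔ non-confinement of the conditional law of one particle

Conjunct `BoseEinsteinCondensation` of `AtomisticToContinuum`. Write `Z = x :: Y ∈ (ℝ³)^{n+1}`,
`N = n + 1`, and for a wave function `Ψ ≥ 0` and an environment `Y` (the other `n` particles) put

* `A(Y) = ∫_{Λ_L} Ψ(x, Y) dx` (the `L¹` size of the one-particle slice),
* `Q(Y) = ∫_{Λ_L} Ψ(x, Y)² dx` (its `L²` mass = the marginal density of the environment),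
* `p_Y = Ψ(·, Y)² / Q(Y)` (the conditional law of the remaining particle given the others),
* `m(Y) = A(Y)² / (L³ Q(Y)) = 1 / (1 + CV²_Y) ∈ [0, 1]` (`CV_Y` = coefficient of variation of the
  slice over the box).

The zero-momentum occupation is EXACTLY the mean of `m`:
`N₀(Ψ)/N = ⟨φ₀, γ_Ψ φ₀⟩/N = L⁻³ ∫ A(Y)² dY = E_{Y ∼ Q}[m(Y)]`, `φ₀ = L^{-3/2} 1_{Λ_L}`
(`SoloInformed.nnnorm_flatOverlap_eq` is the slice-wise identity `|⟨φ₀, Ψ(·,Y)⟩| = L^{-3/2} A(Y)`).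
This file proves, by Chebyshev and Cauchy–Schwarz on the PEAK SETS `P_t(Y) = Λ_L ∩ {Ψ(·, Y) > t}`,
that `m(Y)` is small if and only if `p_Y` is CONFINED to a small volume fraction:

* (`SoloInformed.peak_confinement`) `t² |P_t| ≤ Q` and `∫_{Λ \ P_t} Ψ(·,Y)² ≤ t A`: choosing
  `t A = η Q` exhibits a set of volume fraction `≤ m/η²` carrying conditional mass `≥ 1 - η`
  (small overlap ⇒ confinement);
* (`SoloInformed.sq_setLIntegral_ge_of_nonconfined`) conversely, if every set of volume `≤ w`
  misses conditional mass `≥ ε` (non-confinement `NC(w, ε)`), then `A² ≥ ε² w Q`, i.e.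
  `m ≥ ε² w / L³` (non-confinement ⇒ overlap);
* (`SoloInformed.flatOccupation_ge_of_nonconfined`) integrating over a set `G` of environments on
  which `NC(w, ε)` holds: `⟨φ₀, γ_Ψ φ₀⟩ ≥ N ε² (w/L³) ∫_G Q(Y) dY`; for a normalised `Ψ` with
  `P_{Y∼Q}(G) ≥ c` and `w = θ L³` this is `N₀ ≥ c ε² θ N`, and with the door
  `SoloInformed.hasGroundStateBEC_of_flatOccupation` (Theorems/SoloInformedModeCriterion) it is the
  form in which zero-momentum BEC would follow.

Reading. Together with the rigidity bound of `Theorems/SoloInformedRigidityBound`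
(`λ_max ≤ N sup_x P_Y[x allowed]`), this locates what a proof of the conjunct must establish about
the dilute Dirichlet ground state `Ψ₀`, uniformly in the volume `L = (N/ρ)^{1/3}`: with positive
probability in the environment `Y ∼ Ψ₀²`, the conditional law of a tagged particle given all the
others is NOT concentrated on a vanishing volume fraction — quantitative deletion-tolerance /
non-rigidity of the ground-state point process in the sense of Ghosh–Peres (arXiv:1211.2381,
rigidity and tolerance of point processes), here shown to be EQUIVALENT (up to explicit powers of
the constants) to macroscopic occupation of the zero mode, `N₀ ≥ cN`. No energy estimate enters;
the statements hold for every nonnegative `Ψ`. The identities behind it are the classical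
Penrose–Onsager / McMillan "teleportation ratio" for `N₀` [cite: PenroseOnsager1956, §4 (6)];
the packaging as a two-sided confinement criterion is [folklore]-level measure theory and is the
content claimed here. Companion report: the soloist seat's `paper/sharpest.md` §3.
-/

noncomputable section

open MeasureTheory Filter Set
open scoped ENNReal NNReal ComplexConjugate

namespace Summit.AtomisticToContinuum.BoseEinsteinCondensation.Theorems

open Literature.MathematicalPhysics.QuantumManyBody.BoseGas

/-! ### Abstract part: peak sets of a nonnegative function on a set of finite mass -/

section Abstract

variable {α : Type*} [MeasurableSpace α] {μ : Measure α} {f : α → ℝ≥0∞} {B : Set α}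

/-- **Chebyshev for the peak set.** `t² · μ(B ∩ {f > t}) ≤ ∫_B f²`. [folklore] -/
theorem SoloInformed.sq_mul_measure_peak_le (hf : Measurable f) (B : Set α) (t : ℝ≥0∞) :
    t ^ 2 * μ (B ∩ {x | t < f x}) ≤ ∫⁻ x in B, f x ^ 2 ∂μ := by
  have hS : MeasurableSet {x | t ^ 2 ≤ f x ^ 2} :=
    measurableSet_le measurable_const (hf.pow_const 2)
  calc t ^ 2 * μ (B ∩ {x | t < f x})
      ≤ t ^ 2 * μ.restrict B {x | t ^ 2 ≤ f x ^ 2} := by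
        rw [Measure.restrict_apply hS]
        refine mul_le_mul_right (measure_mono ?_) _
        intro x hx
        exact ⟨show t ^ 2 ≤ f x ^ 2 from pow_le_pow_left' (le_of_lt (show t < f x from hx.2)) 2, hx.1⟩
    _ ≤ ∫⁻ x in B, f x ^ 2 ∂μ := mul_meas_ge_le_lintegral₀ (hf.pow_const 2).aemeasurable _

/-- **Off the peak set `f ≤ t`, so `∫_D f² ≤ t ∫_D f`.** [folklore] -/
theorem SoloInformed.setLIntegral_sq_le_of_le (hf : Measurable f) {D : Set α}
    (hD : MeasurableSet D) {t : ℝ≥0∞} (hle : ∀ x ∈ D, f x ≤ t) :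
    ∫⁻ x in D, f x ^ 2 ∂μ ≤ t * ∫⁻ x in D, f x ∂μ := by
  calc ∫⁻ x in D, f x ^ 2 ∂μ ≤ ∫⁻ x in D, t * f x ∂μ := by
        refine lintegral_mono_ae ((ae_restrict_iff' hD).2 (Eventually.of_forall fun x hx => ?_))
        rw [sq]
        exact mul_le_mul_left (hle x hx) (f x)
    _ = t * ∫⁻ x in D, f x ∂μ := lintegral_const_mul t hf

/-- **Small mean ⇒ confinement (the peak set carries the mass and is small).** For every height
`t`: `t² μ(P_t) ≤ ∫_B f²` and `∫_{B \ P_t} f² ≤ t ∫_B f`, `P_t = B ∩ {f > t}`. Reading, with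
`Q = ∫_B f²`, `A = ∫_B f`, `m = A²/(μ(B) Q)`: the choice `t A = η Q` gives a set `P_t` of measure
`≤ Q/t² = (m/η²) μ(B)` outside of which lies at most `η Q` of the mass — a function with small
`L¹`-to-`L²` ratio has its square confined to a small fraction of `B`. [folklore] -/
theorem SoloInformed.peak_confinement (hf : Measurable f) (hB : MeasurableSet B) (t : ℝ≥0∞) :
    t ^ 2 * μ (B ∩ {x | t < f x}) ≤ ∫⁻ x in B, f x ^ 2 ∂μ ∧
      ∫⁻ x in B \ (B ∩ {x | t < f x}), f x ^ 2 ∂μ ≤ t * ∫⁻ x in B, f x ∂μ := by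
  refine ⟨SoloInformed.sq_mul_measure_peak_le hf B t, ?_⟩
  have hP : MeasurableSet (B ∩ {x | t < f x}) := hB.inter (measurableSet_lt measurable_const hf)
  calc ∫⁻ x in B \ (B ∩ {x | t < f x}), f x ^ 2 ∂μ
      ≤ t * ∫⁻ x in B \ (B ∩ {x | t < f x}), f x ∂μ :=
        SoloInformed.setLIntegral_sq_le_of_le hf (hB.diff hP) fun x hx =>
          not_lt.1 fun h => hx.2 ⟨hx.1, h⟩
    _ ≤ t * ∫⁻ x in B, f x ∂μ := mul_le_mul_right (lintegral_mono_set Set.sdiff_subset) t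

/-- Division bookkeeping in `ℝ≥0∞`: `(Q / w) · m ≤ Q` with `0 < Q < ∞`, `w < ∞` forces `m ≤ w`.
[folklore] -/
theorem SoloInformed.le_of_div_mul_le {Q w m : ℝ≥0∞} (hQ0 : Q ≠ 0) (hQt : Q ≠ ⊤) (hwt : w ≠ ⊤)
    (h : Q / w * m ≤ Q) : m ≤ w := by
  refine not_lt.1 fun hlt => ?_
  by_cases hw0 : w = 0
  · subst hw0
    rw [ENNReal.div_zero hQ0, ENNReal.top_mul hlt.ne'] at h
    exact hQt (top_le_iff.1 h)
  · have h1 : Q / w ≠ 0 := (ENNReal.div_pos_iff.2 ⟨hQ0, hwt⟩).ne'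
    have h2 : Q / w ≠ ⊤ := ENNReal.div_ne_top hQt hw0
    have h3 : Q / w * w < Q / w * m := ENNReal.mul_lt_mul_right h1 h2 hlt
    rw [ENNReal.div_mul_cancel hw0 hwt] at h3
    exact lt_irrefl Q (h3.trans_le h)

/-- **Non-confinement ⇒ reverse Hölder (`L¹` against `L²`).** If `∫_B f² < ∞` and every
measurable `S ⊆ B` of measure `≤ w` misses at least the fraction `ε` of the square-mass,
`ε ∫_B f² ≤ ∫_{B \ S} f²` (non-confinement `NC(w, ε)`), then `(∫_B f)² ≥ ε² w ∫_B f²`.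
Proof: the peak set `P_t` with `t² = (∫_B f²)/w` has measure `≤ w` (Chebyshev), so `NC` and the
off-peak bound give `ε ∫_B f² ≤ t ∫_B f`; square. [folklore] -/
theorem SoloInformed.sq_setLIntegral_ge_of_nonconfined (hf : Measurable f) (hB : MeasurableSet B)
    {ε w : ℝ≥0∞} (hwt : w ≠ ⊤) (hQ : ∫⁻ x in B, f x ^ 2 ∂μ ≠ ⊤)
    (hNC : ∀ S, MeasurableSet S → S ⊆ B → μ S ≤ w →
      ε * ∫⁻ x in B, f x ^ 2 ∂μ ≤ ∫⁻ x in B \ S, f x ^ 2 ∂μ) :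
    ε ^ 2 * w * ∫⁻ x in B, f x ^ 2 ∂μ ≤ (∫⁻ x in B, f x ∂μ) ^ 2 := by
  set Q := ∫⁻ x in B, f x ^ 2 ∂μ with hQdef
  set A := ∫⁻ x in B, f x ∂μ with hAdef
  by_cases hQ0 : Q = 0
  · simp [hQ0]
  by_cases hw0 : w = 0
  · simp [hw0]
  -- the height `t` with `t² = Q / w`
  set t : ℝ≥0∞ := (Q / w) ^ (1 / 2 : ℝ) with htdef
  have ht2 : t ^ 2 = Q / w := by
    rw [htdef, ← ENNReal.rpow_two, ← ENNReal.rpow_mul]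
    norm_num
  have hPmeas : MeasurableSet (B ∩ {x | t < f x}) :=
    hB.inter (measurableSet_lt measurable_const hf)
  -- the peak set has measure `≤ w`
  have hPvol : μ (B ∩ {x | t < f x}) ≤ w := by
    refine SoloInformed.le_of_div_mul_le hQ0 hQ hwt ?_
    rw [← ht2]
    exact (SoloInformed.peak_confinement hf hB t).1
  -- non-confinement at the peak set, then the off-peak bound
  have h1 : ε * Q ≤ t * A :=
    (hNC _ hPmeas Set.inter_subset_left hPvol).trans (SoloInformed.peak_confinement hf hB t).2
  -- square and cancel the factor `Q / w`
  have h2 : ε ^ 2 * Q ^ 2 ≤ Q / w * A ^ 2 := by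
    calc ε ^ 2 * Q ^ 2 = (ε * Q) ^ 2 := (mul_pow ε Q 2).symm
      _ ≤ (t * A) ^ 2 := pow_le_pow_left' h1 2
      _ = Q / w * A ^ 2 := by rw [mul_pow, ht2]
  have h3 : Q / w ≠ 0 := (ENNReal.div_pos_iff.2 ⟨hQ0, hwt⟩).ne'
  have h4 : Q / w ≠ ⊤ := ENNReal.div_ne_top hQ hw0
  have hwQ : w * (Q / w) = Q := ENNReal.mul_div_cancel hw0 hwt
  have h5 : ε ^ 2 * w * Q * (Q / w) ≤ A ^ 2 * (Q / w) := by
    calc ε ^ 2 * w * Q * (Q / w) = ε ^ 2 * Q * (w * (Q / w)) := by ring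
      _ = ε ^ 2 * Q ^ 2 := by rw [hwQ]; ring
      _ ≤ Q / w * A ^ 2 := h2
      _ = A ^ 2 * (Q / w) := mul_comm _ _
  exact (ENNReal.mul_le_mul_iff_left h3 h4).1 h5

end Abstract

/-! ### The flat mode: overlap = `L^{-3/2} ×` the `L¹` size of the slice -/

variable {n : ℕ}

/-- `‖(r : ℂ)‖₊ = r` in `ℝ≥0∞` for `r ≥ 0`. [folklore] -/
theorem SoloInformed.coe_nnnorm_ofReal_of_nonneg {r : ℝ} (hr : 0 ≤ r) :
    ((‖(r : ℂ)‖₊ : ℝ≥0) : ℝ≥0∞) = ENNReal.ofReal r := by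
  rw [← enorm_eq_nnnorm, ← ofReal_norm, Complex.norm_real, Real.norm_of_nonneg hr]

/-- `‖z‖₊ = ofReal ‖z‖` in `ℝ≥0∞`. [folklore] -/
theorem SoloInformed.coe_nnnorm_eq_ofReal_norm (z : ℂ) :
    ((‖z‖₊ : ℝ≥0) : ℝ≥0∞) = ENNReal.ofReal ‖z‖ := by
  rw [← enorm_eq_nnnorm, ← ofReal_norm]

/-- **Flat-mode overlap of a nonnegative wave function.** If `Ψ ≥ 0` pointwise (as a real-valued
complex function) and the slice `x ↦ Ψ(x, Y)` is integrable on `Λ_L`, then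
`|∫ conj(L^{-3/2} 1_{Λ_L}) Ψ(·, Y)| = L^{-3/2} ∫_{Λ_L} Ψ(x, Y) dx` (for `Ψ ≥ 0` the modulus of the
overlap is the `L¹` size of the slice). [cite: PenroseOnsager1956, §4 (6)] -/
theorem SoloInformed.nnnorm_flatOverlap_eq {Ψ : Config (n + 1) → ℂ} (hΨ : Measurable Ψ)
    (hΨ0 : ∀ Z, Ψ Z = ((‖Ψ Z‖ : ℝ) : ℂ)) {L : ℝ} (Y : Config n)
    (hint : IntegrableOn (fun x => ‖Ψ (Matrix.vecCons x Y)‖) (box L)) :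
    (‖∫ x, conj ((box L).indicator (fun _ => ((Real.sqrt ((L ^ 3)⁻¹) : ℝ) : ℂ)) x) *
        Ψ (Matrix.vecCons x Y)‖₊ : ℝ≥0∞) =
      ENNReal.ofReal (Real.sqrt ((L ^ 3)⁻¹)) *
        ∫⁻ x in box L, (‖Ψ (Matrix.vecCons x Y)‖₊ : ℝ≥0∞) := by
  set c : ℝ := Real.sqrt ((L ^ 3)⁻¹) with hcdef
  have hc0 : 0 ≤ c := Real.sqrt_nonneg _
  have hmeas : MeasurableSet (box L) := by
    rw [SoloInformed.box_eq_preimage]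
    exact (PiLp.continuous_ofLp 2 _).measurable (MeasurableSet.univ_pi fun _ => measurableSet_Ioo)
  set g : Space → ℝ := (box L).indicator fun x => c * ‖Ψ (Matrix.vecCons x Y)‖ with hgdef
  have hg0 : ∀ x, 0 ≤ g x := fun x =>
    Set.indicator_nonneg (fun y _ => mul_nonneg hc0 (norm_nonneg _)) x
  -- the integrand is the real function `g`, cast to `ℂ`
  have hpt : ∀ x, conj ((box L).indicator (fun _ => ((c : ℝ) : ℂ)) x) * Ψ (Matrix.vecCons x Y) =
      ((g x : ℝ) : ℂ) := by
    intro x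
    by_cases hx : x ∈ box L
    · have hval : g x = c * ‖Ψ (Matrix.vecCons x Y)‖ := by
        rw [hgdef, Set.indicator_of_mem hx]
      rw [Set.indicator_of_mem hx, Complex.conj_ofReal, hval]
      conv_lhs => rw [hΨ0 (Matrix.vecCons x Y)]
      push_cast
      ring
    · simp [hgdef, hx]
  have hgi : Integrable g := by
    rw [hgdef, integrable_indicator_iff hmeas]
    exact hint.const_mul c
  have hI : (∫ x, conj ((box L).indicator (fun _ => ((c : ℝ) : ℂ)) x) * Ψ (Matrix.vecCons x Y)) =
      ((∫ x, g x : ℝ) : ℂ) := by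
    rw [show (fun x => conj ((box L).indicator (fun _ => ((c : ℝ) : ℂ)) x) *
        Ψ (Matrix.vecCons x Y)) = fun x => ((g x : ℝ) : ℂ) from funext hpt]
    exact integral_ofReal
  rw [hI, SoloInformed.coe_nnnorm_ofReal_of_nonneg (integral_nonneg hg0),
    ofReal_integral_eq_lintegral_ofReal hgi (Eventually.of_forall hg0)]
  -- pointwise: `ofReal (g x) = 1_{Λ}(x) · ofReal c · ‖Ψ(x, Y)‖₊`
  have hpt2 : ∀ x, ENNReal.ofReal (g x) =
      (box L).indicator (fun x => ENNReal.ofReal c * (‖Ψ (Matrix.vecCons x Y)‖₊ : ℝ≥0∞)) x := by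
    intro x
    by_cases hx : x ∈ box L
    · have hval : g x = c * ‖Ψ (Matrix.vecCons x Y)‖ := by
        rw [hgdef, Set.indicator_of_mem hx]
      rw [hval, Set.indicator_of_mem hx, ENNReal.ofReal_mul hc0,
        SoloInformed.coe_nnnorm_eq_ofReal_norm (Ψ (Matrix.vecCons x Y))]
    · simp [hgdef, hx]
  simp_rw [hpt2]
  rw [lintegral_indicator hmeas,
    lintegral_const_mul _ (measurable_comp_vecCons_left hΨ Y).nnnorm.coe_nnreal_ennreal]

/-- **Non-confinement forces zero-momentum occupation (quantitative).** Let `Ψ ≥ 0` pointwise,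
measurable, with integrable slices on `Λ_L`, `L > 0`. Suppose that on a measurable set `G` of
environments `Y` the slice has finite square-mass `Q(Y) = ∫_{Λ_L} Ψ(x,Y)² dx < ∞` and is
non-confined at volume `w < ∞` with leakage `ε`: every measurable `S ⊆ Λ_L` with `|S| ≤ w` has
`∫_{Λ_L \ S} Ψ(·,Y)² ≥ ε Q(Y)`. Then
`⟨φ₀, γ_Ψ φ₀⟩ ≥ N · L⁻³ ε² w · ∫_G Q(Y) dY`, `φ₀ = L^{-3/2} 1_{Λ_L}`, `N = n + 1`.
For a normalised `Ψ` supported in `Λ_L^N` with `P_{Y ∼ Q}(G) ≥ c` and `w = θ L³` this reads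
`N₀ ≥ c ε² θ N`: macroscopic occupation of the zero mode follows from (and, by
`SoloInformed.peak_confinement`, is equivalent up to powers of the constants to) non-confinement of
the conditional law of one particle given the others, on a set of environments of positive
probability. [folklore] -/
theorem SoloInformed.flatOccupation_ge_of_nonconfined {Ψ : Config (n + 1) → ℂ} (hΨ : Measurable Ψ)
    (hΨ0 : ∀ Z, Ψ Z = ((‖Ψ Z‖ : ℝ) : ℂ)) {L : ℝ} (hL : 0 < L)
    (hint : ∀ Y : Config n, IntegrableOn (fun x => ‖Ψ (Matrix.vecCons x Y)‖) (box L))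
    {G : Set (Config n)} (hG : MeasurableSet G) {ε w : ℝ≥0∞} (hwt : w ≠ ⊤)
    (hfin : ∀ Y ∈ G, ∫⁻ x in box L, (‖Ψ (Matrix.vecCons x Y)‖₊ : ℝ≥0∞) ^ 2 ≠ ⊤)
    (hNC : ∀ Y ∈ G, ∀ S, MeasurableSet S → S ⊆ box L → volume S ≤ w →
      ε * ∫⁻ x in box L, (‖Ψ (Matrix.vecCons x Y)‖₊ : ℝ≥0∞) ^ 2 ≤
        ∫⁻ x in box L \ S, (‖Ψ (Matrix.vecCons x Y)‖₊ : ℝ≥0∞) ^ 2) :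
    (n + 1 : ℝ≥0∞) * ((ENNReal.ofReal (L ^ 3))⁻¹ * (ε ^ 2 * w) *
        ∫⁻ Y in G, ∫⁻ x in box L, (‖Ψ (Matrix.vecCons x Y)‖₊ : ℝ≥0∞) ^ 2) ≤
      occupation (n + 1)
        ((box L).indicator (fun _ => ((Real.sqrt ((L ^ 3)⁻¹) : ℝ) : ℂ))) Ψ := by
  have hmeas : MeasurableSet (box L) := by
    rw [SoloInformed.box_eq_preimage]
    exact (PiLp.continuous_ofLp 2 _).measurable (MeasurableSet.univ_pi fun _ => measurableSet_Ioo)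
  have hκ : 0 ≤ (L ^ 3)⁻¹ := inv_nonneg.2 (pow_nonneg hL.le 3)
  have hc2 : ENNReal.ofReal (Real.sqrt ((L ^ 3)⁻¹)) ^ 2 = (ENNReal.ofReal (L ^ 3))⁻¹ := by
    rw [← ENNReal.ofReal_pow (Real.sqrt_nonneg _), Real.sq_sqrt hκ,
      ENNReal.ofReal_inv_of_pos (pow_pos hL 3)]
  rw [occupation]
  refine mul_le_mul_right ?_ _
  calc (ENNReal.ofReal (L ^ 3))⁻¹ * (ε ^ 2 * w) *
          ∫⁻ Y in G, ∫⁻ x in box L, (‖Ψ (Matrix.vecCons x Y)‖₊ : ℝ≥0∞) ^ 2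
      ≤ ∫⁻ Y in G, (ENNReal.ofReal (L ^ 3))⁻¹ * (ε ^ 2 * w) *
          ∫⁻ x in box L, (‖Ψ (Matrix.vecCons x Y)‖₊ : ℝ≥0∞) ^ 2 := lintegral_const_mul_le _ _
    _ ≤ ∫⁻ Y in G, (‖∫ x, conj ((box L).indicator (fun _ => ((Real.sqrt ((L ^ 3)⁻¹) : ℝ) : ℂ)) x) *
          Ψ (Matrix.vecCons x Y)‖₊ : ℝ≥0∞) ^ 2 := by
        refine lintegral_mono_ae ((ae_restrict_iff' hG).2 (Eventually.of_forall fun Y hY => ?_))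
        rw [SoloInformed.nnnorm_flatOverlap_eq hΨ hΨ0 Y (hint Y), mul_pow, hc2, mul_assoc]
        exact mul_le_mul_right
          (SoloInformed.sq_setLIntegral_ge_of_nonconfined
            (measurable_comp_vecCons_left hΨ Y).nnnorm.coe_nnreal_ennreal
            hmeas hwt (hfin Y hY) (hNC Y hY)) _
    _ ≤ ∫⁻ Y, (‖∫ x, conj ((box L).indicator (fun _ => ((Real.sqrt ((L ^ 3)⁻¹) : ℝ) : ℂ)) x) *
          Ψ (Matrix.vecCons x Y)‖₊ : ℝ≥0∞) ^ 2 := lintegral_mono' Measure.restrict_le_self le_rfl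

end Summit.AtomisticToContinuum.BoseEinsteinCondensation.Theorems

end
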